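import Mathlib
import HarnessLib.Audit.Tags

/-!
# The divisibility form of the pair-sum certificate implies its root form (TODO-29 remainder (b2′); bus R311/R315)

Honest framing: elementary commutative algebra over `ℚ`, PROVED; no curve, no Galois-image determination, no
modularity claim, no new census, nothing numerical, no instrument touched.  This file imports nothing from the cell
(only Mathlib), so the gate can check it while the `ImprimitiveCertificates` olean lag keeps the sibling files
`TwoBlocksSharp.lean` (p371977), `PairSumCertificate.lean` (p372254) pending.  The cell's rung-23a instrument
`res23.py` certifies an irreducible integer sextic `f` (leading coefficient `lc`) as imprimitive with two-element
blocks by a monic irreducible cubic `S̃ ∈ ℤ[Y]` (roots `lc·sᵢ`, `sᵢ` the three pair sums) and the integer divisibility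
`f(x) ∣ R_inst(x) := Norm_{ℤ[x][Y]/(S̃)}(lc⁶·f(Y/lc − x))`.  `PairSumCertificate.lean` typed the ROOT FORM of this
certificate (every root `r` has a root `y` of `S` with `f(y − r) = 0`, `S` a rational cubic with roots `sᵢ`) and
proved ROOT FORM ⇒ `HasTwoBlocks`.  This file proves the step before it with Mathlib's resultant
(`Polynomial.resultant` = Sylvester determinant, `resultant_map_map`, `resultant_eq_zero_iff`): the RATIONAL
DIVISIBILITY FORM `F(x) ∣ R(x) := Res_Y(S(Y), F(Y − x))` in `ℚ[x]` (Sylvester sizes `3, 6`) implies the root form over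
any field in which `S` splits (`pairSum_of_dvd_resultant`), in particular over the splitting field of `F·S` in exactly
the shape of the hypothesis `hpair` of `hasTwoBlocks_of_pairSum` (`pairSum_splittingField_of_dvd_resultant`); the
two-line composite `hasTwoBlocks_of_dvd_resultant` (registered R311 (5)) is filed separately once p372254 is in the
tree (bus R315).  What is NOT typed (b2″, bus R314): the identity `R_inst(x) = ± lc¹⁸ · R(x)` between the instrument's
norm and the Sylvester resultant (norm over a monic cubic = product over its roots = resultant up to the unit
`lc¹⁸`); it makes `f ∣ R_inst` and `F ∣ R` equivalent and is recorded, not formalised.  The exact statement of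
`pairSum_of_dvd_resultant` was registered on the cell bus BEFORE any proof (R311, cell «pub-residmod», 2026-08-23).

Mechanism.  In `ℚ[X][X]` the outer variable is `Y` and the constant `C X` is `x`, so `(F.map C).comp (X − C X)` is
`F(Y − x)`.  For a root `r ∈ E` of `F`, the evaluation `x ↦ r` (`(aeval r).toRingHom : ℚ[x] →+* E`) kills `F`, hence
kills `R`; resultants commute with ring maps at fixed Sylvester sizes (`resultant_map_map`), so
`Res_Y(S_E, F_E(Y − r)) = 0` with the sizes equal to the actual degrees `3, 6` (`natDegree_comp`); over the field `E`
this means `S_E` and `F_E(Y − r)` are not coprime (`resultant_eq_zero_iff`), so (`isCoprime_of_dvd`, contrapositive)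
they have a common non-unit divisor `z`; `z` divides the split polynomial `S_E`, hence splits and has a root `y ∈ E`
(`Splits.of_dvd`, `Splits.exists_eval_eq_zero`), which is a root of `S` with `F(y − r) = 0`.  No Galois theory and no
irreducibility is used.

Main results (all PROVED, axioms `propext`, `Classical.choice`, `Quot.sound` only):
* `pairSum_of_dvd_resultant` — divisibility form ⇒ root form, over any field `E ⊇ ℚ` in which `S` splits;
* `pairSum_splittingField_of_dvd_resultant` — the same over `SplittingField (F * S)`, literally the hypothesis `hpair`
  of `hasTwoBlocks_of_pairSum` (`PairSumCertificate.lean`) for `F = toRatPoly f`.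
Technical note: over the base field `ℚ` instance search picks `DivisionRing.toRatAlgebra` for
`Algebra ℚ (SplittingField _)`; as in the sibling files the type of `SplittingField.splits` is therefore ascribed.
-/

open Polynomial

namespace Summit.Ventures.ResidMod.Conjectures

section Resultant

/-- **(b2′) The rational divisibility form of the pair-sum certificate gives its root form.**  Let
`F, S ∈ ℚ[X]` have degrees `6` and `3`, let `S` split in the field `E ⊇ ℚ`, and suppose
`F(x) ∣ R(x) := Res_Y(S(Y), F(Y − x))` in `ℚ[x]` (Sylvester sizes `3, 6`; in `ℚ[X][X]` the outer variable is `Y`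
and `C X` is `x`).  Then every root `r ∈ E` of `F` has a root `y ∈ E` of `S` with `F(y − r) = 0`: specialising
`x ↦ r` (`resultant_map_map` along `aeval r`) gives `Res_Y(S, F(Y − r)) = 0` in `E`, so `S` and `F(Y − r)` are
not coprime in `E[Y]` (`resultant_eq_zero_iff`), and a common non-unit divisor of the split polynomial `S` has a
root in `E`.  No Galois theory and no irreducibility is used. [elementary commutative algebra] -/
theorem pairSum_of_dvd_resultant {E : Type*} [Field E] [Algebra ℚ E] {F S : ℚ[X]}
    (hF6 : F.natDegree = 6) (hS3 : S.natDegree = 3) (hsplitS : (S.map (algebraMap ℚ E)).Splits)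
    (hdvd : F ∣ resultant (S.map (C : ℚ →+* ℚ[X])) ((F.map (C : ℚ →+* ℚ[X])).comp (X - C (X : ℚ[X]))) 3 6) :
    ∀ r ∈ F.rootSet E, ∃ y ∈ S.rootSet E, y - r ∈ F.rootSet E := by
  classical
  intro r hr
  have hF0 : F ≠ 0 := by rintro rfl; simp at hF6
  have hS0 : S ≠ 0 := by rintro rfl; simp at hS3
  have hrF : aeval r F = 0 := (mem_rootSet.mp hr).2
  -- specialise `x ↦ r`
  set ev : ℚ[X] →+* E := (aeval r : ℚ[X] →ₐ[ℚ] E).toRingHom with hev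
  have hevC : ev.comp C = algebraMap ℚ E := Subsingleton.elim _ _
  have hevX : ev X = r := by simp [hev]
  have hevF : ev F = 0 := by simp [hev, hrF]
  set SE : E[X] := S.map (algebraMap ℚ E) with hSE
  set FE : E[X] := F.map (algebraMap ℚ E) with hFE
  set G : E[X] := FE.comp (X - C r) with hG
  have hmapS : (S.map (C : ℚ →+* ℚ[X])).map ev = SE := by
    rw [Polynomial.map_map, hevC]
  have hmapG : ((F.map (C : ℚ →+* ℚ[X])).comp (X - C (X : ℚ[X]))).map ev = G := by
    rw [Polynomial.map_comp, Polynomial.map_map, hevC, Polynomial.map_sub, map_X, map_C, hevX]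
  -- the resultant vanishes at `x = r`
  have hres : resultant SE G 3 6 = 0 := by
    obtain ⟨c, hc⟩ := hdvd
    have h := congrArg ev hc
    rw [map_mul, hevF, zero_mul, ← resultant_map_map, hmapS, hmapG] at h
    exact h
  have hSEdeg : SE.natDegree = 3 := by
    rw [hSE, natDegree_map_eq_of_injective (algebraMap ℚ E).injective, hS3]
  have hFEdeg : FE.natDegree = 6 := by
    rw [hFE, natDegree_map_eq_of_injective (algebraMap ℚ E).injective, hF6]
  have hGdeg : G.natDegree = 6 := by
    rw [hG, natDegree_comp, hFEdeg, natDegree_X_sub_C]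
  have hres' : resultant SE G = 0 := by
    rw [← hSEdeg, ← hGdeg] at hres
    exact hres
  have hncop : ¬ IsCoprime SE G := (resultant_eq_zero_iff.mp hres').2
  have hSE0 : SE ≠ 0 := (Polynomial.map_ne_zero_iff (algebraMap ℚ E).injective).mpr hS0
  -- a common non-unit divisor of `SE` and `G` has a root, which is the wanted `y`
  by_contra hno
  refine hncop (isCoprime_of_dvd _ _ (fun h => hSE0 h.1) fun z hz _ hzS hzG => ?_)
  have hzdeg : z.degree ≠ 0 := fun h0 => (mem_nonunits_iff.mp hz) (Polynomial.isUnit_iff_degree_eq_zero.mpr h0)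
  obtain ⟨y, hy⟩ := (hsplitS.of_dvd hSE0 hzS).exists_eval_eq_zero hzdeg
  have hyS : SE.eval y = 0 := eval_eq_zero_of_dvd_of_eval_eq_zero hzS hy
  have hyG : G.eval y = 0 := eval_eq_zero_of_dvd_of_eval_eq_zero hzG hy
  rw [hSE, eval_map_algebraMap] at hyS
  rw [hG, eval_comp, eval_sub, eval_X, eval_C, hFE, eval_map_algebraMap] at hyG
  exact hno ⟨y, mem_rootSet.mpr ⟨hS0, hyS⟩, mem_rootSet.mpr ⟨hF0, hyG⟩⟩

end Resultant

/-- **The divisibility form over the splitting field of `F·S`.**  For `F, S ∈ ℚ[X]` of degrees `6, 3` with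
`F ∣ Res_Y(S(Y), F(Y − x))`, every root `r` of `F` in the splitting field of `F·S` has a root `y` of `S` there with
`F(y − r) = 0` — verbatim the hypothesis `hpair` of `hasTwoBlocks_of_pairSum` (`PairSumCertificate.lean`, p372254)
when `F = toRatPoly f`. [elementary commutative algebra] -/
theorem pairSum_splittingField_of_dvd_resultant {F S : ℚ[X]} (hF6 : F.natDegree = 6) (hS3 : S.natDegree = 3)
    (hdvd : F ∣ resultant (S.map (C : ℚ →+* ℚ[X])) ((F.map (C : ℚ →+* ℚ[X])).comp (X - C (X : ℚ[X]))) 3 6) :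
    ∀ r ∈ F.rootSet (F * S).SplittingField, ∃ y ∈ S.rootSet (F * S).SplittingField,
      y - r ∈ F.rootSet (F * S).SplittingField := by
  have hF0 : F ≠ 0 := by rintro rfl; simp at hF6
  have hS0 : S ≠ 0 := by rintro rfl; simp at hS3
  have hFS0 : F * S ≠ 0 := mul_ne_zero hF0 hS0
  -- type ascribed on purpose (see the technical note in the module docstring)
  have hsplit : ((F * S).map (algebraMap ℚ (F * S).SplittingField)).Splits := SplittingField.splits (F * S)
  have hne : (F * S).map (algebraMap ℚ (F * S).SplittingField) ≠ 0 :=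
    (Polynomial.map_ne_zero_iff (algebraMap ℚ _).injective).mpr hFS0
  exact pairSum_of_dvd_resultant hF6 hS3 (hsplit.of_dvd hne (Polynomial.map_dvd _ (dvd_mul_left _ _))) hdvd

end Summit.Ventures.ResidMod.Conjectures
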